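import Literature.MathematicalPhysics.StatisticalMechanics.SeparatedShellSums
import Literature.MathematicalPhysics.StatisticalMechanics.MuGroundStateConfiguration

/-!
# FrustratedLawDichotomy · crux `AperiodicFrustratedLawGap` (stmt-AtomisticToContinuum-27623) — SHARP FAR-FIELD LATTICE SUMS
# over separated point sets (packing + Abel summation; DEF-FREE; decomp-a2c, prover hand 2, structural share, generation 15)

The optimality line's motif-local exemption tests (`…ExemptLocal`, `…ExemptMove`) pay a far-field slack `2K·T(D)` with the tree's
crude constant `T(D) ≈ 2612/D³` (`…GSCVanHoveBalls.abs_tsum_field_le_of_far`, from the dyadic bound `Σ_{|a−p| ≥ R} |a−p|^{-(k+3)} ≤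
1024/(δ³Rᵏ)` of `…ExcessDecayLiouvilleFarField`), unusable below `D ≈ 140` (hand-1 g14, critic row 543 (B1)).  This module proves the SHARP
packing bound — the exact value of the Abel integral `∫_R^∞ (k+3)r^{-(k+4)}P(r)dr` against the cumulative packing majorant
`P(r) = (2r/δ+1)³ − (2R/δ−1)³` of `Literature…SeparatedShellSums.card_le_of_separated_of_mem_shell` — with neither integrals nor limits:

* `sum_le_of_antitone_of_card_le` — ABSTRACT PACKING–ABEL LEMMA (`f ≥ 0` antitone on `[R,∞)`, `#{points with distance ≤ D} ≤ P(D)`,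
  `f(y)(P(y) − P(x)) ≤ Φ(x) − Φ(y)` for `R ≤ x ≤ y`, `Φ ≥ 0` ⟹ `Σ f(dₐ) ≤ Φ(R) + f(R)P(R)`; induction on the farthest point);
* `inv_pow_mul_pow_sub_pow_le` (`y^{-(a+i)}(yⁱ − xⁱ) ≤ (i/a)(x^{-a} − y^{-a})`), `inv_pow_sub_inv_pow_le` (`x^{-n} − y^{-n} ≤ n(y−x)x^{-(n+1)}`);
* ★ `sum_inv_pow_le_of_separated_sharp` — finite `δ`-separated `s ⊂ ℝ³` at distance `≥ R ≥ δ/2` from `p`, `k ≥ 1`: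
  `Σ_{a ∈ s} |a − p|^{-(k+3)} ≤ (3/k)(2/δ)³R^{-k} + (6(k+2)/(k+1))(2/δ)²R^{-(k+1)} + (3/(k+2))(2/δ)R^{-(k+2)} + 2R^{-(k+3)}` (leading term
  `= (6/(πδ³))·∫_{|x| ≥ R}|x|^{-(k+3)}dx`, 128× below the dyadic constant); uniform corollary `…_sharp'` (`≤ 64/(δ³Rᵏ)` for `R ≥ δ`, a
  drop-in for `1024/(δ³Rᵏ)`);
* ★ `abs_tsum_field_le_of_far_sharp` — `δ`-separated `Y`, all points `≥ Rc ≥ max(1, δ/2)` from `z`: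
  `|Σ' V_LJ| ≤ (1/6)(8/δ³·Rc⁻³ + 30/δ²·Rc⁻⁴ + 6/(5δ)·Rc⁻⁵ + 2Rc⁻⁶)`; at `δ = 7/10` (`…_sevenTenths`):
  `T♯(D) = 4000/(1029D³) + 500/(49D⁴) + 2/(7D⁵) + 1/(3D⁶)` — `T♯(10) = 4.9·10⁻³`, `T♯(20) = 5.5·10⁻⁴` (tree: `T(20) = 0.33`).

All `[folklore]` (volume packing + summation by parts); helper lemmas, nothing here closes an item.
-/
noncomputable section

namespace Summit.AtomisticToContinuum.Crystallization.Theorems.FrustratedLawDichotomyFarFieldSharp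

open scoped BigOperators
open Literature.MathematicalPhysics.StatisticalMechanics

/-! ## §1. The abstract packing–Abel lemma -/

/-- **ABSTRACT PACKING–ABEL LEMMA.**  Let `d : ι → ℝ` ("distances") satisfy `R ≤ d x` on the finite set `s`; let `f` be non-negative and
antitone on `[R, ∞)`, `Φ` non-negative on `[R, ∞)` with `f(y)·(P(y) − P(x)) ≤ Φ(x) − Φ(y)` for `R ≤ x ≤ y` (a discrete
"`Φ(x) ≥ ∫_x^∞ f dP`"), and suppose every `t ⊆ s` whose distances lie in `[R, D]` has `#t ≤ P(D)` ("packing").  Then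
`Σ_{x ∈ s} f(d x) ≤ Φ(R) + f(R)·P(R)`.  (Proof: adding the points in increasing distance, the quantity
`Σ f + Φ(D) + f(D)(P(D) − #)` never increases.) [folklore] -/
theorem sum_le_of_antitone_of_card_le {ι : Type*} (s : Finset ι) (d : ι → ℝ) (f P Φ : ℝ → ℝ) (R : ℝ)
    (hR : ∀ x ∈ s, R ≤ d x) (hf : ∀ x y : ℝ, R ≤ x → x ≤ y → f y ≤ f x) (hf0 : ∀ x : ℝ, R ≤ x → 0 ≤ f x)
    (hΦ0 : ∀ x : ℝ, R ≤ x → 0 ≤ Φ x) (hstep : ∀ x y : ℝ, R ≤ x → x ≤ y → f y * (P y - P x) ≤ Φ x - Φ y)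
    (hcard : ∀ t ⊆ s, ∀ D : ℝ, R ≤ D → (∀ x ∈ t, d x ≤ D) → (t.card : ℝ) ≤ P D) :
    ∑ x ∈ s, f (d x) ≤ Φ R + f R * P R := by
  classical
  -- the invariant, by induction on the farthest point
  have key : ∀ t : Finset ι, t ⊆ s → ∀ D : ℝ, R ≤ D → (∀ x ∈ t, d x ≤ D) →
      ∑ x ∈ t, f (d x) + Φ D + f D * (P D - t.card) ≤ Φ R + f R * P R := by
    intro t
    induction t using Finset.induction_on_max_value d with
    | empty =>
      intro _ D hD _
      have hP0 : (0 : ℝ) ≤ P R := by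
        have := hcard ∅ (Finset.empty_subset _) R le_rfl (by simp)
        simpa using this
      have h1 := hstep R D le_rfl hD
      have h2 : f D * P R ≤ f R * P R := mul_le_mul_of_nonneg_right (hf R D le_rfl hD) hP0
      simp only [Finset.sum_empty, Finset.card_empty, Nat.cast_zero, sub_zero, zero_add]
      nlinarith
    | insert a t hat hmax ih =>
      intro hsub D hD hle
      have has : a ∈ s := hsub (Finset.mem_insert_self a t)
      have hts : t ⊆ s := fun x hx => hsub (Finset.mem_insert_of_mem hx)
      have hRa : R ≤ d a := hR a has
      have haD : d a ≤ D := hle a (Finset.mem_insert_self a t)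
      have ih' := ih hts (d a) hRa hmax
      have hP : ((insert a t).card : ℝ) ≤ P (d a) :=
        hcard (insert a t) hsub (d a) hRa fun x hx => by
          rcases Finset.mem_insert.1 hx with rfl | hx
          · exact le_rfl
          · exact hmax x hx
      rw [Finset.card_insert_of_notMem hat, Nat.cast_add, Nat.cast_one] at hP ⊢
      rw [Finset.sum_insert hat]
      have h1 := hstep (d a) D hRa haD
      have hfD : f D ≤ f (d a) := hf (d a) D hRa haD
      have hnn : (0 : ℝ) ≤ P (d a) - (t.card + 1) := by linarith
      have h2 : f D * (P (d a) - (t.card + 1)) ≤ f (d a) * (P (d a) - (t.card + 1)) :=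
        mul_le_mul_of_nonneg_right hfD hnn
      nlinarith
  -- a radius `D ≥ R` beyond every point
  obtain ⟨M, hM⟩ := (s.image d).exists_le
  set D : ℝ := max R M with hDdef
  have hD : R ≤ D := le_max_left _ _
  have hle : ∀ x ∈ s, d x ≤ D := fun x hx => (hM (d x) (Finset.mem_image_of_mem d hx)).trans (le_max_right _ _)
  have h := key s le_rfl D hD hle
  have hP : (s.card : ℝ) ≤ P D := hcard s le_rfl D hD hle
  have h3 : 0 ≤ f D * (P D - s.card) := mul_nonneg (hf0 D hD) (by linarith)
  linarith [hΦ0 D hD]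

/-! ## §2. Bernoulli-type steps for inverse powers -/

/-- `n(t − 1) ≤ tⁿ − 1` for `1 ≤ t` (Bernoulli). [folklore] -/
theorem mul_sub_one_le_pow_sub_one {t : ℝ} (ht : 1 ≤ t) (n : ℕ) : n * (t - 1) ≤ t ^ n - 1 := by
  have := one_add_mul_sub_le_pow (show (-1 : ℝ) ≤ t by linarith) n
  linarith

/-- **The Abel step for inverse powers**: `y^{-(a+i)}·(yⁱ − xⁱ) ≤ (i/a)·(x^{-a} − y^{-a})` for `0 < x ≤ y`, `a ≥ 1`
(a discrete `∫_x^y i r^{i−1}·r^{-(a+i)} dr ≥ y^{-(a+i)}(yⁱ − xⁱ)`). [folklore] -/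
theorem inv_pow_mul_pow_sub_pow_le {x y : ℝ} (hx : 0 < x) (hxy : x ≤ y) {a : ℕ} (ha : 1 ≤ a) (i : ℕ) :
    y⁻¹ ^ (a + i) * (y ^ i - x ^ i) ≤ (i / a : ℝ) * (x⁻¹ ^ a - y⁻¹ ^ a) := by
  have hy : 0 < y := hx.trans_le hxy
  have ha0 : (0 : ℝ) < a := by exact_mod_cast ha
  -- ratio `r = x/y ∈ (0,1]`, `t = y/x ≥ 1`
  set r : ℝ := x * y⁻¹ with hr
  set t : ℝ := y * x⁻¹ with ht
  have hr0 : 0 < r := by positivity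
  have hr1 : r ≤ 1 := by rw [hr, mul_inv_le_iff₀ hy, one_mul]; exact hxy
  have ht1 : 1 ≤ t := by rw [ht, le_mul_inv_iff₀ hx, one_mul]; exact hxy
  have hrt : r * t = 1 := by rw [hr, ht]; field_simp
  -- rewrite both sides
  have hL : y⁻¹ ^ (a + i) * (y ^ i - x ^ i) = y⁻¹ ^ a * (1 - r ^ i) := by
    have h1 : y⁻¹ ^ i * y ^ i = 1 := by rw [← mul_pow, inv_mul_cancel₀ hy.ne', one_pow]
    have h2 : y⁻¹ ^ i * x ^ i = r ^ i := by rw [← mul_pow, hr, mul_comm]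
    rw [pow_add, mul_assoc, mul_sub, h1, h2]
  have hR : x⁻¹ ^ a - y⁻¹ ^ a = y⁻¹ ^ a * (t ^ a - 1) := by
    have h1 : y⁻¹ ^ a * t ^ a = x⁻¹ ^ a := by
      rw [← mul_pow, ht]
      congr 1
      field_simp
    rw [mul_sub, h1, mul_one]
  rw [hL, hR]
  have hc : 0 ≤ y⁻¹ ^ a := by positivity
  -- `1 − rⁱ ≤ i(1 − r) ≤ i(t − 1) ≤ (i/a)(tᵃ − 1)`
  have h1 : 1 - r ^ i ≤ i * (1 - r) := by
    -- Bernoulli (= `Literature…ChatterjeeJointLimit.one_sub_pow_le'`; two lines, re-derived rather than importing a QFT module)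
    have := one_add_mul_sub_le_pow (show (-1 : ℝ) ≤ r by linarith) i
    linarith
  have h2 : 1 - r ≤ t - 1 := by
    -- `r + t ≥ 2` since `r t = 1`
    nlinarith [sq_nonneg (r - 1), hrt, hr0]
  have h3 : (a : ℝ) * (t - 1) ≤ t ^ a - 1 := mul_sub_one_le_pow_sub_one ht1 a
  have hi0 : (0 : ℝ) ≤ i := Nat.cast_nonneg i
  have h4 : 1 - r ^ i ≤ (i / a : ℝ) * (t ^ a - 1) := by
    calc 1 - r ^ i ≤ i * (t - 1) := h1.trans (mul_le_mul_of_nonneg_left h2 hi0)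
      _ = (i / a : ℝ) * (a * (t - 1)) := by field_simp
      _ ≤ (i / a : ℝ) * (t ^ a - 1) := mul_le_mul_of_nonneg_left h3 (by positivity)
  calc y⁻¹ ^ a * (1 - r ^ i) ≤ y⁻¹ ^ a * ((i / a : ℝ) * (t ^ a - 1)) := mul_le_mul_of_nonneg_left h4 hc
    _ = (i / a : ℝ) * (y⁻¹ ^ a * (t ^ a - 1)) := by ring

/-- **Inverse-power differences**: `x^{-n} − y^{-n} ≤ n(y − x)x^{-(n+1)}` for `0 < x ≤ y`. [folklore] -/
theorem inv_pow_sub_inv_pow_le {x y : ℝ} (hx : 0 < x) (hxy : x ≤ y) (n : ℕ) :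
    x⁻¹ ^ n - y⁻¹ ^ n ≤ n * (y - x) * x⁻¹ ^ (n + 1) := by
  have hy : 0 < y := hx.trans_le hxy
  set r : ℝ := x * y⁻¹ with hr
  have hr0 : 0 < r := by positivity
  have hL : x⁻¹ ^ n - y⁻¹ ^ n = x⁻¹ ^ n * (1 - r ^ n) := by
    have h1 : x⁻¹ ^ n * r ^ n = y⁻¹ ^ n := by
      rw [← mul_pow, hr]
      congr 1
      field_simp
    rw [mul_sub, mul_one, h1]
  have h1 : 1 - r ^ n ≤ n * (1 - r) := by
    have := one_add_mul_sub_le_pow (show (-1 : ℝ) ≤ r by linarith) n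
    linarith
  have h2 : 1 - r ≤ (y - x) * x⁻¹ := by
    rw [hr]
    have : 1 - x * y⁻¹ = (y - x) * y⁻¹ := by field_simp
    rw [this]
    exact mul_le_mul_of_nonneg_left ((inv_le_inv₀ hy hx).2 hxy) (by linarith)
  have hn0 : (0 : ℝ) ≤ n := Nat.cast_nonneg n
  have hc : 0 ≤ x⁻¹ ^ n := by positivity
  calc x⁻¹ ^ n - y⁻¹ ^ n = x⁻¹ ^ n * (1 - r ^ n) := hL
    _ ≤ x⁻¹ ^ n * (n * ((y - x) * x⁻¹)) :=
        mul_le_mul_of_nonneg_left (h1.trans (mul_le_mul_of_nonneg_left h2 hn0)) hc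
    _ = n * (y - x) * x⁻¹ ^ (n + 1) := by ring

/-! ## §3. Inverse powers against a cubic packing majorant -/

/-- **The Abel step for `f(r) = r^{-(k+3)}` against a cubic `P(r) = c₃r³ + c₂r² + c₁r + c₀`** (`c₁, c₂, c₃ ≥ 0`, `k ≥ 1`): with
`Φ(r) = (3c₃/k)r^{-k} + (2c₂/(k+1))r^{-(k+1)} + (c₁/(k+2))r^{-(k+2)}` (`= ∫_r^∞ f dP`), `f(y)(P(y) − P(x)) ≤ Φ(x) − Φ(y)` for
`0 < x ≤ y`. [folklore] -/
theorem inv_pow_mul_cubic_sub_le {x y : ℝ} (hx : 0 < x) (hxy : x ≤ y) {k : ℕ} (hk : 1 ≤ k) {c₃ c₂ c₁ : ℝ}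
    (h₃ : 0 ≤ c₃) (h₂ : 0 ≤ c₂) (h₁ : 0 ≤ c₁) (c₀ : ℝ) :
    y⁻¹ ^ (k + 3) * ((c₃ * y ^ 3 + c₂ * y ^ 2 + c₁ * y + c₀) - (c₃ * x ^ 3 + c₂ * x ^ 2 + c₁ * x + c₀)) ≤
      (3 * c₃ / k * x⁻¹ ^ k + 2 * c₂ / (k + 1) * x⁻¹ ^ (k + 1) + c₁ / (k + 2) * x⁻¹ ^ (k + 2)) -
        (3 * c₃ / k * y⁻¹ ^ k + 2 * c₂ / (k + 1) * y⁻¹ ^ (k + 1) + c₁ / (k + 2) * y⁻¹ ^ (k + 2)) := by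
  have e3 := inv_pow_mul_pow_sub_pow_le hx hxy hk 3
  have e2 := inv_pow_mul_pow_sub_pow_le hx hxy (a := k + 1) (by omega) 2
  have e1 := inv_pow_mul_pow_sub_pow_le hx hxy (a := k + 2) (by omega) 1
  rw [show k + 1 + 2 = k + 3 by ring] at e2
  rw [show k + 2 + 1 = k + 3 by ring] at e1
  simp only [pow_one, Nat.cast_ofNat, Nat.cast_one, Nat.cast_add] at e1 e2 e3
  have f3 := mul_le_mul_of_nonneg_left e3 h₃
  have f2 := mul_le_mul_of_nonneg_left e2 h₂
  have f1 := mul_le_mul_of_nonneg_left e1 h₁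
  have hk0 : (0 : ℝ) < k := by exact_mod_cast hk
  have hL : y⁻¹ ^ (k + 3) * ((c₃ * y ^ 3 + c₂ * y ^ 2 + c₁ * y + c₀) - (c₃ * x ^ 3 + c₂ * x ^ 2 + c₁ * x + c₀)) =
      c₃ * (y⁻¹ ^ (k + 3) * (y ^ 3 - x ^ 3)) + c₂ * (y⁻¹ ^ (k + 3) * (y ^ 2 - x ^ 2)) +
        c₁ * (y⁻¹ ^ (k + 3) * (y ^ 1 - x ^ 1)) := by ring
  have hR : (3 * c₃ / k * x⁻¹ ^ k + 2 * c₂ / (k + 1) * x⁻¹ ^ (k + 1) + c₁ / (k + 2) * x⁻¹ ^ (k + 2)) -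
        (3 * c₃ / k * y⁻¹ ^ k + 2 * c₂ / (k + 1) * y⁻¹ ^ (k + 1) + c₁ / (k + 2) * y⁻¹ ^ (k + 2)) =
      c₃ * (3 / (k : ℝ) * (x⁻¹ ^ k - y⁻¹ ^ k)) + c₂ * (2 / ((k : ℝ) + 1) * (x⁻¹ ^ (k + 1) - y⁻¹ ^ (k + 1))) +
        c₁ * (1 / ((k : ℝ) + 2) * (x⁻¹ ^ (k + 2) - y⁻¹ ^ (k + 2))) := by
    field_simp
    ring
  rw [hL, hR]
  simp only [pow_one] at f1 ⊢
  linarith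

/-- Inverse powers are antitone on `(0, ∞)`. [folklore] -/
theorem inv_pow_le_inv_pow_of_le {x y : ℝ} (hx : 0 < x) (hxy : x ≤ y) (n : ℕ) : y⁻¹ ^ n ≤ x⁻¹ ^ n :=
  pow_le_pow_left₀ (inv_nonneg.2 (hx.le.trans hxy)) ((inv_le_inv₀ (hx.trans_le hxy) hx).2 hxy) n

/-! ## §4. The sharp far-field inverse-power sum over a separated set -/

/-- **Cumulative packing**: a finite `δ`-separated set in the shell `R ≤ |a − p| ≤ D` of `ℝ³` (`δ/2 ≤ R ≤ D`) has at most
`(2D/δ + 1)³ − (2R/δ − 1)³` points. [folklore] -/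
theorem card_le_of_separated_shell_three (t : Finset (EuclideanSpace ℝ (Fin 3))) (p : EuclideanSpace ℝ (Fin 3))
    {δ R D : ℝ} (hδ : 0 < δ) (hR : δ / 2 ≤ R) (hRD : R ≤ D)
    (hsep : ∀ a ∈ t, ∀ b ∈ t, a ≠ b → δ ≤ dist a b) (ht : ∀ a ∈ t, R ≤ dist a p ∧ dist a p ≤ D) :
    (t.card : ℝ) ≤ (2 * D / δ + 1) ^ 3 - (2 * R / δ - 1) ^ 3 := by
  have hD0 : 0 ≤ D := le_trans (by linarith) hRD
  have h := card_le_of_separated_of_mem_shell t p hδ hD0 hRD ht hsep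
  rw [finrank_euclideanSpace_fin] at h
  have hmax : max (2 * R / δ - 1) 0 = 2 * R / δ - 1 := by
    refine max_eq_left ?_
    rw [sub_nonneg, le_div_iff₀ hδ]
    linarith
  rwa [hmax] at h

/-- ★ **SHARP FAR-FIELD INVERSE-POWER SUM** (packing + Abel summation, exact value of the Abel integral): for a finite `δ`-separated
`s ⊂ ℝ³` all of whose points are at distance `≥ R ≥ δ/2` from `p`, and `k ≥ 1`,
`Σ_{a ∈ s} |a − p|^{-(k+3)} ≤ (3/k)(2/δ)³R^{-k} + (6(k+2)/(k+1))(2/δ)²R^{-(k+1)} + (3/(k+2))(2/δ)R^{-(k+2)} + 2R^{-(k+3)}`. [folklore] -/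
theorem sum_inv_pow_le_of_separated_sharp (s : Finset (EuclideanSpace ℝ (Fin 3))) (p : EuclideanSpace ℝ (Fin 3))
    {δ R : ℝ} {k : ℕ} (hk : 1 ≤ k) (hδ : 0 < δ) (hR : δ / 2 ≤ R)
    (hsep : ∀ a ∈ s, ∀ b ∈ s, a ≠ b → δ ≤ dist a b) (hfar : ∀ a ∈ s, R ≤ dist a p) :
    ∑ a ∈ s, (dist a p)⁻¹ ^ (k + 3) ≤
      3 / (k : ℝ) * (2 / δ) ^ 3 * R⁻¹ ^ k + 6 * ((k : ℝ) + 2) / ((k : ℝ) + 1) * (2 / δ) ^ 2 * R⁻¹ ^ (k + 1) +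
        3 / ((k : ℝ) + 2) * (2 / δ) * R⁻¹ ^ (k + 2) + 2 * R⁻¹ ^ (k + 3) := by
  have hRpos : 0 < R := lt_of_lt_of_le (by positivity) hR
  have hk0 : (0 : ℝ) < k := by exact_mod_cast hk
  set u : ℝ := 2 / δ with hu
  have hu0 : 0 ≤ u := by positivity
  -- the data of the abstract lemma
  set f : ℝ → ℝ := fun r => r⁻¹ ^ (k + 3) with hf
  set P : ℝ → ℝ := fun r => u ^ 3 * r ^ 3 + 3 * u ^ 2 * r ^ 2 + 3 * u * r + (1 - (u * R - 1) ^ 3) with hP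
  set Φ : ℝ → ℝ := fun r => 3 * u ^ 3 / k * r⁻¹ ^ k + 2 * (3 * u ^ 2) / (k + 1) * r⁻¹ ^ (k + 1) +
    3 * u / (k + 2) * r⁻¹ ^ (k + 2) with hΦ
  have hPeq : ∀ r, P r = (2 * r / δ + 1) ^ 3 - (2 * R / δ - 1) ^ 3 := fun r => by
    simp only [hP, hu]; ring
  have main := sum_le_of_antitone_of_card_le s (fun a => dist a p) f P Φ R hfar
    (fun x y hx hxy => inv_pow_le_inv_pow_of_le (hRpos.trans_le hx) hxy _)
    (fun x hx => by simp only [hf]; have := hRpos.trans_le hx; positivity)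
    (fun x hx => by simp only [hΦ]; have := hRpos.trans_le hx; positivity)
    (fun x y hx hxy => by
      simp only [hf, hΦ]
      exact inv_pow_mul_cubic_sub_le (hRpos.trans_le hx) hxy hk (by positivity) (by positivity) (by positivity) _)
    (fun t hts D hD htD => by
      rw [hPeq]
      exact card_le_of_separated_shell_three t p hδ hR hD (fun a ha b hb hab => hsep a (hts ha) b (hts hb) hab)
        fun a ha => ⟨hfar a (hts ha), htD a ha⟩)
  refine main.trans (le_of_eq ?_)
  have h6 : 6 * ((k : ℝ) + 2) / ((k : ℝ) + 1) = 6 + 6 / ((k : ℝ) + 1) := by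
    have hk1 : ((k : ℝ) + 1) ≠ 0 := by positivity
    field_simp
    ring
  have hv : R * R⁻¹ = 1 := mul_inv_cancel₀ hRpos.ne'
  simp only [hf, hΦ, hP]
  rw [h6, pow_succ R⁻¹ k, pow_add R⁻¹ k 2, pow_add R⁻¹ k 3]
  linear_combination (6 * u ^ 2 * R⁻¹ ^ k * R⁻¹ * (R⁻¹ * R + 1)) * hv

/-- **Uniform corollary** (drop-in for the tree's dyadic `1024/(δ³Rᵏ)`): under `δ ≤ R`, `Σ_{a ∈ s} |a − p|^{-(k+3)} ≤ 64/(δ³Rᵏ)`. [folklore] -/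
theorem sum_inv_pow_le_of_separated_sharp' (s : Finset (EuclideanSpace ℝ (Fin 3))) (p : EuclideanSpace ℝ (Fin 3))
    {δ R : ℝ} {k : ℕ} (hk : 1 ≤ k) (hδ : 0 < δ) (hδR : δ ≤ R)
    (hsep : ∀ a ∈ s, ∀ b ∈ s, a ≠ b → δ ≤ dist a b) (hfar : ∀ a ∈ s, R ≤ dist a p) :
    ∑ a ∈ s, (dist a p)⁻¹ ^ (k + 3) ≤ 64 / (δ ^ 3 * R ^ k) := by
  have hRpos : 0 < R := hδ.trans_le hδR
  have hk0 : (1 : ℝ) ≤ k := by exact_mod_cast hk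
  have h := sum_inv_pow_le_of_separated_sharp s p hk hδ (by linarith) hsep hfar
  refine h.trans ?_
  have hiR : R⁻¹ ≤ δ⁻¹ := (inv_le_inv₀ hRpos hδ).2 hδR
  have hRk : 0 < R⁻¹ ^ k := by positivity
  -- each term is at most a multiple of `δ⁻³ R⁻ᵏ`
  have e0 : 64 / (δ ^ 3 * R ^ k) = 64 * δ⁻¹ ^ 3 * R⁻¹ ^ k := by
    rw [inv_pow, inv_pow]; field_simp
  have t1 : 3 / (k : ℝ) * (2 / δ) ^ 3 * R⁻¹ ^ k ≤ 24 * δ⁻¹ ^ 3 * R⁻¹ ^ k := by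
    have h3k : 3 / (k : ℝ) ≤ 3 := div_le_self (by norm_num) hk0
    have : (2 / δ) ^ 3 = 8 * δ⁻¹ ^ 3 := by rw [div_eq_mul_inv, mul_pow]; norm_num
    rw [this]
    nlinarith [show 0 < δ⁻¹ ^ 3 * R⁻¹ ^ k by positivity]
  have t2 : 6 * ((k : ℝ) + 2) / ((k : ℝ) + 1) * (2 / δ) ^ 2 * R⁻¹ ^ (k + 1) ≤ 36 * δ⁻¹ ^ 3 * R⁻¹ ^ k := by
    have h6 : 6 * ((k : ℝ) + 2) / ((k : ℝ) + 1) ≤ 9 := by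
      rw [div_le_iff₀ (by positivity)]; nlinarith
    have h22 : (2 / δ) ^ 2 = 4 * δ⁻¹ ^ 2 := by rw [div_eq_mul_inv, mul_pow]; norm_num
    rw [h22, pow_succ]
    have hδ2 : 0 < δ⁻¹ ^ 2 := by positivity
    calc 6 * ((k : ℝ) + 2) / ((k : ℝ) + 1) * (4 * δ⁻¹ ^ 2) * (R⁻¹ ^ k * R⁻¹)
        ≤ 9 * (4 * δ⁻¹ ^ 2) * (R⁻¹ ^ k * δ⁻¹) := by
          apply mul_le_mul (mul_le_mul_of_nonneg_right h6 (by positivity))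
            (mul_le_mul_of_nonneg_left hiR hRk.le) (by positivity) (by positivity)
      _ = 36 * δ⁻¹ ^ 3 * R⁻¹ ^ k := by ring
  have t3 : 3 / ((k : ℝ) + 2) * (2 / δ) * R⁻¹ ^ (k + 2) ≤ 2 * δ⁻¹ ^ 3 * R⁻¹ ^ k := by
    have h3 : 3 / ((k : ℝ) + 2) ≤ 1 := by rw [div_le_iff₀ (by positivity)]; linarith
    have hR2 : R⁻¹ ^ 2 ≤ δ⁻¹ ^ 2 := pow_le_pow_left₀ (by positivity) hiR 2
    rw [pow_add, div_eq_mul_inv 2 δ]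
    calc 3 / ((k : ℝ) + 2) * (2 * δ⁻¹) * (R⁻¹ ^ k * R⁻¹ ^ 2) ≤ 1 * (2 * δ⁻¹) * (R⁻¹ ^ k * δ⁻¹ ^ 2) := by
          apply mul_le_mul (mul_le_mul_of_nonneg_right h3 (by positivity))
            (mul_le_mul_of_nonneg_left hR2 hRk.le) (by positivity) (by positivity)
      _ = 2 * δ⁻¹ ^ 3 * R⁻¹ ^ k := by ring
  have t4 : 2 * R⁻¹ ^ (k + 3) ≤ 2 * δ⁻¹ ^ 3 * R⁻¹ ^ k := by
    have hR3 : R⁻¹ ^ 3 ≤ δ⁻¹ ^ 3 := pow_le_pow_left₀ (by positivity) hiR 3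
    rw [pow_add]
    nlinarith
  rw [e0]
  linarith

/-! ## §5. The Lennard-Jones far field, sharp -/

/-- ★ **SHARP LENNARD-JONES FAR FIELD**: if `Y ⊆ ℝ³` is `δ`-separated and every point of `Y` is at distance `≥ Rc` from `z`, with
`Rc ≥ 1` and `Rc ≥ δ/2`, then `|Σ'_{y ∈ Y} V_LJ(dist z y)| ≤ (1/6)·(8/δ³·Rc⁻³ + 30/δ²·Rc⁻⁴ + 6/(5δ)·Rc⁻⁵ + 2·Rc⁻⁶)`.
At `δ = 7/10`: `T♯(Rc) = 4000/(1029 Rc³) + 500/(49 Rc⁴) + 2/(7 Rc⁵) + 1/(3 Rc⁶)` (vs. the tree's `≈ 2612/Rc³`). [folklore] -/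
theorem abs_tsum_field_le_of_far_sharp {δ : ℝ} {Y : Set (EuclideanSpace ℝ (Fin 3))} (hδ : 0 < δ)
    (hsep : ∀ a ∈ Y, ∀ b ∈ Y, a ≠ b → δ ≤ dist a b) (z : EuclideanSpace ℝ (Fin 3)) {Rc : ℝ} (hRc : 1 ≤ Rc)
    (hδRc : δ / 2 ≤ Rc) (hfar : ∀ y ∈ Y, Rc ≤ dist z y) :
    |∑' y : ↥Y, lennardJones (dist z y)| ≤
      1 / 6 * (8 / δ ^ 3 * Rc⁻¹ ^ 3 + 30 / δ ^ 2 * Rc⁻¹ ^ 4 + 6 / (5 * δ) * Rc⁻¹ ^ 5 + 2 * Rc⁻¹ ^ 6) := by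
  classical
  have hY : UniformlyDiscrete Y := ⟨δ, hδ, hsep⟩
  have hsum : Summable fun y : ↥Y => lennardJones (dist z y) := hY.summable_lennardJones_dist z
  have habs : |∑' y : ↥Y, lennardJones (dist z y)| ≤ ∑' y : ↥Y, |lennardJones (dist z y)| := by
    have h0 : Summable fun y : ↥Y => ‖lennardJones (dist z y)‖ := hsum.norm
    have := norm_tsum_le_tsum_norm h0
    simpa only [Real.norm_eq_abs] using this
  refine habs.trans (hsum.abs.tsum_le_of_sum_le fun u => ?_)
  set u' : Finset (EuclideanSpace ℝ (Fin 3)) := u.image Subtype.val with hu'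
  have hmem : ∀ y ∈ u', y ∈ Y := fun y hy => by
    rw [hu', Finset.mem_image] at hy
    obtain ⟨w, -, rfl⟩ := hy
    exact w.2
  have hsum_eq : ∑ y ∈ u, |lennardJones (dist z y)| = ∑ y ∈ u', |lennardJones (dist z y)| := by
    rw [hu', Finset.sum_image (fun a _ b _ h => Subtype.ext h)]
  rw [hsum_eq]
  have hsep' : ∀ a ∈ u', ∀ b ∈ u', a ≠ b → δ ≤ dist a b := fun a ha b hb hab => hsep a (hmem a ha) b (hmem b hb) hab
  have hfar' : ∀ y ∈ u', Rc ≤ dist y z := fun y hy => by rw [dist_comm]; exact hfar y (hmem y hy)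
  have h6 := sum_inv_pow_le_of_separated_sharp u' z (k := 3) (by norm_num) hδ hδRc hsep' hfar'
  -- `|V_LJ(r)| ≤ r⁻⁶/6` for `r ≥ 1` (= `…LoopTunnelDialRangeTails.abs_lennardJones_le_of_one_le`, whose cone imports `Literature…MuGSC`
  -- and is therefore not importable next to `Literature…MuGroundStateConfiguration`; re-derived inline)
  have hLJ : ∀ r : ℝ, 1 ≤ r → |lennardJones r| ≤ 1 / 6 * r⁻¹ ^ 6 := fun r hr => by
    have hw0 : 0 ≤ r⁻¹ ^ 6 := by positivity
    have hw1 : r⁻¹ ^ 6 ≤ 1 := pow_le_one₀ (by positivity) (inv_le_one_of_one_le₀ hr)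
    have h12 : r⁻¹ ^ 12 = r⁻¹ ^ 6 * r⁻¹ ^ 6 := by ring
    unfold lennardJones
    rw [abs_le]
    constructor
    · nlinarith [mul_nonneg hw0 hw0]
    · nlinarith [mul_le_mul_of_nonneg_left hw1 hw0]
  have hterm : ∀ y ∈ u', |lennardJones (dist z y)| ≤ 1 / 6 * (dist y z)⁻¹ ^ (3 + 3) := fun y hy => by
    rw [dist_comm]
    exact hLJ _ (hRc.trans (hfar' y hy))
  calc ∑ y ∈ u', |lennardJones (dist z y)| ≤ ∑ y ∈ u', 1 / 6 * (dist y z)⁻¹ ^ (3 + 3) := Finset.sum_le_sum hterm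
    _ = 1 / 6 * ∑ y ∈ u', (dist y z)⁻¹ ^ (3 + 3) := by rw [Finset.mul_sum]
    _ ≤ 1 / 6 * (3 / ((3 : ℕ) : ℝ) * (2 / δ) ^ 3 * Rc⁻¹ ^ 3 +
          6 * (((3 : ℕ) : ℝ) + 2) / (((3 : ℕ) : ℝ) + 1) * (2 / δ) ^ 2 * Rc⁻¹ ^ (3 + 1) +
          3 / (((3 : ℕ) : ℝ) + 2) * (2 / δ) * Rc⁻¹ ^ (3 + 2) + 2 * Rc⁻¹ ^ (3 + 3)) :=
        mul_le_mul_of_nonneg_left h6 (by norm_num)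
    _ = 1 / 6 * (8 / δ ^ 3 * Rc⁻¹ ^ 3 + 30 / δ ^ 2 * Rc⁻¹ ^ 4 + 6 / (5 * δ) * Rc⁻¹ ^ 5 + 2 * Rc⁻¹ ^ 6) := by
        norm_num
        field_simp
        ring

/-- **At separation `7/10`** (the crux line's hard core): for `Rc ≥ 1`,
`|Σ'_{y ∈ Y} V_LJ(dist z y)| ≤ 4000/(1029 Rc³) + 500/(49 Rc⁴) + 2/(7 Rc⁵) + 1/(3 Rc⁶)`. [folklore] -/
theorem abs_tsum_field_le_of_far_sharp_sevenTenths {Y : Set (EuclideanSpace ℝ (Fin 3))}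
    (hsep : ∀ a ∈ Y, ∀ b ∈ Y, a ≠ b → (7 : ℝ) / 10 ≤ dist a b) (z : EuclideanSpace ℝ (Fin 3)) {Rc : ℝ} (hRc : 1 ≤ Rc)
    (hfar : ∀ y ∈ Y, Rc ≤ dist z y) :
    |∑' y : ↥Y, lennardJones (dist z y)| ≤
      4000 / 1029 * Rc⁻¹ ^ 3 + 500 / 49 * Rc⁻¹ ^ 4 + 2 / 7 * Rc⁻¹ ^ 5 + 1 / 3 * Rc⁻¹ ^ 6 := by
  have h := abs_tsum_field_le_of_far_sharp (by norm_num : (0 : ℝ) < 7 / 10) hsep z hRc (by linarith) hfar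
  refine h.trans (le_of_eq ?_)
  norm_num
  ring

end Summit.AtomisticToContinuum.Crystallization.Theorems.FrustratedLawDichotomyFarFieldSharp

end
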